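import Literature.AlgebraicGeometry.Frobenioids.Cor411OfPreStepsData
import Literature.AlgebraicGeometry.Frobenioids.Cor411OfPreStepsWeak
import Literature.AlgebraicGeometry.Frobenioids.Thm49CompatOfPreStepsWeak
import HarnessLib

/-!
# Frobenioids I, Corollary 4.11 (iii)/(iv): the DATA form of (iv) and (iii) WITH its compatibility clause,
# from Corollary 4.11 (ii) and the conclusion of Theorem 3.4 (ii), for Frobenioids with WEAKLY perf-factorial
# `Φ_i` — weak twin of `Cor411OfPreStepsData.lean`

Mochizuki, *The geometry of Frobenioids I: the general theory*, Kyushu J. Math. **62** (2008)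
293–400, kurims text: Cor. 4.11 (iii), (iv) p. 92, proof p. 94 [cite: MochizukiFrdI2008, Cor. 4.11 (iv) p.92];
Theorem 4.9 pp. 88–90.

PROOF-ONLY weak twin (cell abc-iut, layer L1, seat abc-iut-L1-t11; [FrdI] Thm. 4.9 / Cor. 4.11 (iii)(iv) WEAK
programme, block (T3) top, basename fence of 2026-08-26 with seat abc-iut-L1-t14) of the two statements of
`Cor411OfPreStepsData.lean` (seat abc-iut-L1-d6): the SAME statements with the §4 standing hypothesis "`Φ_i`
perf-factorial" (Def. 2.4 (i) (a)–(d) as printed) REPLACED by the named weakening `IsPerfFactorialWeak` of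
`PerfFactorialWeak.lean` ((a)–(c) verbatim + (d_ord), (d_res); cell finding F-L2d2-1: (d) fails for the divisor
monoids of the tempered Frobenioids of [EtTh] §3–§5, where [EtTh] Cor. 3.8 (iii) / Prop. 5.3 invoke the `Ψ^Φ` of
[FrdI] Thm. 4.9 and [IUTchI] Def. 3.6 (a) invokes Cor. 4.11 (iv) at `v ∈ V^bad`). Proofs verbatim, perf-factorial
inputs re-targeted BY NAME to `FrdI.exists_divisorMonoidIsoOver_div_of_cor411Setting_of_preservesPreSteps_weak`
(`Cor411OfPreStepsWeak.lean`) and `FrdI.T49.exists_thm49_compat_ofFunctor_of_preservesPreSteps_weak`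
(`Thm49CompatOfPreStepsWeak.lean`, seat abc-iut-L1-t14); the hypothesis-free pieces
(`FrdI.preservesDegFr_of_cor411Setting_of_preservesPreSteps`, seat abc-iut-L1-d6's descents / rigidity
`DivisorMonoidIsoOver.exists_overBase`, `cor411ivRigid_of_*`, …) are consumed BY NAME; (d) itself is never used.
Names = strong names + `_weak`. The printed (strong) case is recovered through `IsPerfFactorial.weak`. No new
definitions; nothing printed is restated as if corrected; nothing here bears on [IUTchIII] Cor. 3.12.

* `FrdI.exists_cor411iv_data_ofFunctor_of_cor411ii_of_preservesPreSteps_weak` — the data `(Ψ^Base, η, Ψ^Φ)` of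
  (iv) with the divisor formula on all arrows, the typed rigidity clause and the slim-base rigidity clause;
* `FrdI.exists_cor411iii_compat_ofFunctor_of_cor411ii_of_preservesPreSteps_weak` — (iii) WITH its compatibility
  clause with `Ψ^Prime` (isotropic non-group-like case, `Thm42Setting`).
-/

namespace Literature.AlgebraicGeometry.Frobenioids

open CategoryTheory Opposite

universe w v v' u u'

namespace FrdI

open PreFrobenioid

variable {D₁ : Type u} [Category.{v} D₁] {Φ₁ : D₁ᵒᵖ ⥤ CommMonCat.{w}} {C₁ : Type u'} [Category.{v'} C₁]
  {D₂ : Type u} [Category.{v} D₂] {Φ₂ : D₂ᵒᵖ ⥤ CommMonCat.{w}} {C₂ : Type u'} [Category.{v'} C₂]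
  {F₁ : C₁ ⥤ ElemFrobenioid Φ₁} {F₂ : C₂ ⥤ ElemFrobenioid Φ₂}

/-- **[FrdI] Cor. 4.11 (iv) for CONSUMERS — the data `(Ψ^Base, η, Ψ^Φ)` with the divisor formula and the
rigidity clause, from Cor. 4.11 (ii) and the conclusion of Thm. 3.4 (ii), NO hypothesis on the bases** ("by
concatenating assertions (ii), (iii), with the fact that `Ψ` preserves Frobenius degrees … each of the composite
functors of this diagram is rigid … via the same argument as … (i)", p. 94): for Frobenioids `C_i → F_{Φ_i}`
with WEAKLY perf-factorial `Φ_i`, `C₁` of rational type at THE birationalization / support, an equivalence `Ψ` such that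
`Ψ`, `Ψ⁻¹` preserve pre-steps and group-like objects, the typed Cor. 4.11 (ii) for `Ψ`, and `Cor411Setting`,
there are `Ψ^Base` (`1`-unique base square), `η : Base₂ ∘ Ψ ≅ Ψ^Base ∘ Base₁` and `Ψ^Φ : Φ₁ ⥲ Φ₂` on `D₁` over
`Ψ^Base` such that `Ψ` preserves Frobenius degrees, `Div(Ψ φ) = η_A^* Ψ^Φ(Div φ)` for EVERY arrow `φ` of `C₁`,
the typed `Cor411ivRigid` holds for this data, and for slim `D_i` the `D`-valued composites are rigid. Twin of
seat abc-iut-L1-t14's `exists_cor411iv_data_ofFunctor_of_isOfFSMType`. [cite: MochizukiFrdI2008, Cor. 4.11 (iv) p.92] -/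
theorem exists_cor411iv_data_ofFunctor_of_cor411ii_of_preservesPreSteps_weak (hF₁ : IsFrobenioid F₁)
    (hF₂ : IsFrobenioid F₂)
    (hpf₁ : Objectwise (fun M _ => IsPerfFactorialWeak M) Φ₁)
    (hpf₂ : Objectwise (fun M _ => IsPerfFactorialWeak M) Φ₂)
    (hrat₁ : ∀ A : C₁, PreFrobenioidData.IsRational
      (biratData hF₁ (hasBiratSquares_of_isFrobenioid hF₁))
      (S := PreFrobenioidData.ofFunctor Φ₁ F₁) (fun a 𝔭 => PrimarySupp a 𝔭) A)
    (Ψ : C₁ ≌ C₂)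
    (h₁₂ : PreFrobenioidData.PreservesMor Ψ.functor (PreFrobenioidData.ofFunctor Φ₁ F₁).IsPreStep
      (PreFrobenioidData.ofFunctor Φ₂ F₂).IsPreStep)
    (h₂₁ : PreFrobenioidData.PreservesMor Ψ.inverse (PreFrobenioidData.ofFunctor Φ₂ F₂).IsPreStep
      (PreFrobenioidData.ofFunctor Φ₁ F₁).IsPreStep)
    (hG : PreFrobenioidData.PreservesObj Ψ.functor (PreFrobenioidData.ofFunctor Φ₁ F₁).IsGroupLikeObj
      (PreFrobenioidData.ofFunctor Φ₂ F₂).IsGroupLikeObj)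
    (hG' : PreFrobenioidData.PreservesObj Ψ.inverse (PreFrobenioidData.ofFunctor Φ₂ F₂).IsGroupLikeObj
      (PreFrobenioidData.ofFunctor Φ₁ F₁).IsGroupLikeObj)
    (hs : (PreFrobenioidData.ofFunctor Φ₁ F₁).Cor411Setting (PreFrobenioidData.ofFunctor Φ₂ F₂) Ψ)
    (h2 : (PreFrobenioidData.ofFunctor Φ₁ F₁).Cor411ii (PreFrobenioidData.ofFunctor Φ₂ F₂) Ψ) :
    ∃ (ΨBase : D₁ ⥤ D₂)
      (E' : (PreFrobenioidData.ofFunctor Φ₁ F₁).DivisorMonoidIsoOverBase (PreFrobenioidData.ofFunctor Φ₂ F₂) ΨBase)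
      (η : Ψ.functor ⋙ (PreFrobenioidData.ofFunctor Φ₂ F₂).base ≅ (PreFrobenioidData.ofFunctor Φ₁ F₁).base ⋙ ΨBase),
      PreFrobenioidData.OneUniqueSquare Ψ.functor (PreFrobenioidData.ofFunctor Φ₁ F₁).base
        (PreFrobenioidData.ofFunctor Φ₂ F₂).base ΨBase ∧
      PreFrobenioidData.PreservesDegFr (PreFrobenioidData.ofFunctor Φ₁ F₁) (PreFrobenioidData.ofFunctor Φ₂ F₂) Ψ ∧
      (∀ ⦃A B : C₁⦄ (φ : A ⟶ B),
        Div F₂ (Ψ.functor.map φ) = pull Φ₂ (η.hom.app A) (E'.iso (baseObj F₁ A) (Div F₁ φ))) ∧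
      (PreFrobenioidData.ofFunctor Φ₁ F₁).Cor411ivRigid (PreFrobenioidData.ofFunctor Φ₂ F₂) Ψ ΨBase E' ∧
      (IsSlim D₁ → IsSlim D₂ → IsRigidFunctor (Ψ.functor ⋙ (PreFrobenioidData.ofFunctor Φ₂ F₂).base) ∧
        IsRigidFunctor ((PreFrobenioidData.ofFunctor Φ₁ F₁).base ⋙ ΨBase)) := by
  obtain ⟨ΨBase, hsq, hrig⟩ := h2 hs
  obtain ⟨η⟩ := hsq.2.1
  obtain ⟨E, hdiv⟩ := exists_divisorMonoidIsoOver_div_of_cor411Setting_of_preservesPreSteps_weak hF₁ hF₂ hpf₁ hpf₂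
    hrat₁ Ψ h₁₂ h₂₁ hG hG' hs
  obtain ⟨E', hE'⟩ := E.exists_overBase ΨBase η (exists_base_iso_of_isFrobenioid F₁ hF₁)
    (exists_preSteps_of_base_iso F₁ hF₁) (fun A _ f => exists_arrow_over_base F₁ hF₁ A f)
  have hdivE : ∀ ⦃A B : C₁⦄ (φ : A ⟶ B), (PreFrobenioidData.ofFunctor Φ₂ F₂).div (Ψ.functor.map φ) =
      (PreFrobenioidData.ofFunctor Φ₂ F₂).pull (η.hom.app A)
        (E'.iso ((PreFrobenioidData.ofFunctor Φ₁ F₁).base.obj A) ((PreFrobenioidData.ofFunctor Φ₁ F₁).div φ)) := by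
    intro A B φ
    rw [hE', ← (PreFrobenioidData.ofFunctor Φ₂ F₂).pull_comp, Iso.hom_inv_id_app,
      (PreFrobenioidData.ofFunctor Φ₂ F₂).pull_id]
    exact (hdiv φ).symm
  exact ⟨ΨBase, E', η, hsq, preservesDegFr_of_cor411Setting_of_preservesPreSteps hF₁ hF₂ Ψ h₁₂ h₂₁ hG hG' hs,
    hdivE, cor411ivRigid_of_square F₁ F₂ Ψ hF₂ ΨBase E' η hdivE, hrig⟩

set_option backward.isDefEq.respectTransparency false in
/-- **[FrdI] Cor. 4.11 (iii) WITH its compatibility clause, for Frobenioids of isotropic, non-group-like type,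
from Cor. 4.11 (ii) and "`Ψ`, `Ψ⁻¹` preserve pre-steps", NO hypothesis on the bases** ("compatible [when the
`C_i` are of isotropic, but not of group-like type] with the isomorphism `Ψ^Prime` of Theorem 4.2, (ii)",
p. 92): under `Thm42Setting` (standard + isotropic + not group-like), perf-factorial `Φ_i`, `C₁` of rational
type at THE birationalization / support, `Cor411Setting`, pre-step preservation for `Ψ`, `Ψ⁻¹` and the typed
Cor. 4.11 (ii) for `Ψ`, there are THE `Ψ^Prime = e` (clauses (a), (b) of Thm. 4.2 (ii)), the `Ψ^Φ` over `Ψ` of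
Thm. 4.9 with `Thm49_compat E e` (seat abc-iut-w4-d105's `FrdI.T49.exists_thm49_compat_ofFunctor_of_preservesPreSteps`),
the `1`-unique `Ψ^Base` with `η`, the descended `Ψ^Φ'` on `D₁` over `Ψ^Base` and bijections of primes `e'` over
`Ψ^Base` induced by `e` for which the typed `Cor411iii_compat Ψ^Φ' e'` holds. Twin of seat abc-iut-L1-t14's
`exists_cor411iii_compat_ofFunctor_of_isOfFSMType`. [cite: MochizukiFrdI2008, Cor. 4.11 (iii) p.92] -/
theorem exists_cor411iii_compat_ofFunctor_of_cor411ii_of_preservesPreSteps_weak (hF₁ : IsFrobenioid F₁)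
    (hF₂ : IsFrobenioid F₂)
    (hpf₁ : Objectwise (fun M _ => IsPerfFactorialWeak M) Φ₁)
    (hpf₂ : Objectwise (fun M _ => IsPerfFactorialWeak M) Φ₂)
    (hrat₁ : ∀ A : C₁, PreFrobenioidData.IsRational
      (biratData hF₁ (hasBiratSquares_of_isFrobenioid hF₁))
      (S := PreFrobenioidData.ofFunctor Φ₁ F₁) (fun a 𝔭 => PrimarySupp a 𝔭) A)
    (Ψ : C₁ ≌ C₂)
    (hT : PreFrobenioidData.Thm42Setting (PreFrobenioidData.ofFunctor Φ₁ F₁) (PreFrobenioidData.ofFunctor Φ₂ F₂))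
    (hs : (PreFrobenioidData.ofFunctor Φ₁ F₁).Cor411Setting (PreFrobenioidData.ofFunctor Φ₂ F₂) Ψ)
    (hpre : ∀ ⦃X Y : C₁⦄ (φ : X ⟶ Y), IsPreStep F₁ φ → IsPreStep F₂ (Ψ.functor.map φ))
    (hpre' : ∀ ⦃X Y : C₂⦄ (φ : X ⟶ Y), IsPreStep F₂ φ → IsPreStep F₁ (Ψ.inverse.map φ))
    (h2 : (PreFrobenioidData.ofFunctor Φ₁ F₁).Cor411ii (PreFrobenioidData.ofFunctor Φ₂ F₂) Ψ) :
    ∃ (e : ∀ A : C₁, Primes (Φ₁.obj (op (baseObj F₁ A))) ≃ Primes (Φ₂.obj (op (baseObj F₂ (Ψ.functor.obj A)))))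
      (E : (PreFrobenioidData.ofFunctor Φ₁ F₁).DivisorMonoidIsoOver (PreFrobenioidData.ofFunctor Φ₂ F₂) Ψ)
      (ΨBase : D₁ ⥤ D₂)
      (η : Ψ.functor ⋙ (PreFrobenioidData.ofFunctor Φ₂ F₂).base ≅ (PreFrobenioidData.ofFunctor Φ₁ F₁).base ⋙ ΨBase)
      (E' : (PreFrobenioidData.ofFunctor Φ₁ F₁).DivisorMonoidIsoOverBase (PreFrobenioidData.ofFunctor Φ₂ F₂) ΨBase)
      (e' : ∀ X : D₁, Primes (Φ₁.obj (op X)) ≃ Primes (Φ₂.obj (op (ΨBase.obj X)))),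
      (∀ (A : C₁) (𝔭 : Primes (Φ₁.obj (op (baseObj F₁ A)))),
        (∀ ⦃B : C₁⦄ (φ : A ⟶ B), IsCoAngularPreStep F₁ φ →
            (Div F₁ φ ∈ 𝔭.submonoid ↔ Div F₂ (Ψ.functor.map φ) ∈ (e A 𝔭).submonoid)) ∧
        ∀ ⦃B : C₁⦄ (ψ : B ⟶ A), IsCoAngularPreStep F₁ ψ →
          ((∃ y ∈ 𝔭.submonoid, pull Φ₁ (Base F₁ ψ) y = Div F₁ ψ) ↔
            ∃ y ∈ (e A 𝔭).submonoid, pull Φ₂ (Base F₂ (Ψ.functor.map ψ)) y = Div F₂ (Ψ.functor.map ψ))) ∧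
      (PreFrobenioidData.ofFunctor Φ₁ F₁).Thm49_compat (PreFrobenioidData.ofFunctor Φ₂ F₂) Ψ E e ∧
      PreFrobenioidData.OneUniqueSquare Ψ.functor (PreFrobenioidData.ofFunctor Φ₁ F₁).base
        (PreFrobenioidData.ofFunctor Φ₂ F₂).base ΨBase ∧
      (∀ (A : C₁) (x : Φ₁.obj (op (baseObj F₁ A))), E'.iso (baseObj F₁ A) x = pull Φ₂ (η.inv.app A) (E.iso A x)) ∧
      (PreFrobenioidData.ofFunctor Φ₁ F₁).Cor411iii_compat (PreFrobenioidData.ofFunctor Φ₂ F₂) E' e' := by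
  obtain ⟨ΨBase, hsq, -⟩ := h2 hs
  obtain ⟨η⟩ := hsq.2.1
  obtain ⟨E, e, he, -, hcompat⟩ := T49.exists_thm49_compat_ofFunctor_of_preservesPreSteps_weak hF₁ hF₂ hpf₁ hpf₂
    hrat₁ Ψ hT hpre hpre'
  obtain ⟨E', hE'⟩ := E.exists_overBase ΨBase η (exists_base_iso_of_isFrobenioid F₁ hF₁)
    (exists_preSteps_of_base_iso F₁ hF₁) (fun A _ f => exists_arrow_over_base F₁ hF₁ A f)
  obtain ⟨e', he'⟩ := E.exists_primes_compat_overBase e ΨBase η E' hE' (exists_base_iso_of_isFrobenioid F₁ hF₁)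
  exact ⟨e, E, ΨBase, η, E', e', he, hcompat, hsq, hE',
    fun h₁ h₂ h₃ h₄ X 𝔭 x => he' (fun A 𝔭 x => hcompat h₁ h₂ h₃ h₄ A 𝔭 x) X 𝔭 x⟩

end FrdI

end Literature.AlgebraicGeometry.Frobenioids
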